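import Literature.NumberTheory.EllipticCurves.TorsionFilAtCyclicMultiplicativeThreeProofs
import Literature.NumberTheory.EllipticCurves.SingularCubic
import Literature.RingTheory.Valuation.AlgClosedResidue
import HarnessLib

/-!
# At a place of MULTIPLICATIVE reduction, `E₀(K̄_v)/E₁(K̄_v) ≅ Ẽ_ns(k̄_v) ≅ k̄_vˣ` has no `p`-torsion (`p` = residue characteristic):
# a point with nonsingular reduction whose `p`-multiple lies in the kernel of reduction already lies in it (theorems only; no definition,
# no named fact, no instance, no `sorry`)

Topic `NumberTheory/EllipticCurves`.  Companion of `TorsionFilAtCyclicMultiplicativeThreeProofs` (LEAD `bsd-wall-utd-p1`, crux r205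
stmt-BirchSwinnertonDyer-24737, line `beta-road`, stub `stub_howardOutputsOfFamily`, E2 unit at `v ∣ 3`).  The one local input of cell x9's
H.4/H.5(b)-at-`p` assemblies still tied to GOOD reduction is the `p`-divisibility of `E₁(K̄_v)` (`exists_nsmul_eq_of_mem_localKernelOfReduction`,
feeding `exists_mem_torsionFilAt_reduce_eq` / `eisensteinTwistTransfer_mem_twistedFil_ordinaryFiltrationAt`).  x9 proves it at a good ordinary
place by «divide in `E(K̄_v)`, then correct by a `p`-torsion point with the same reduction».  At a multiplicative place the same route needs
`(E(K̄_v)/E₁(K̄_v))[p] ⊆ im E[p]`; the exact sequence `0 → E₀/E₁ → E/E₁ → E/E₀ → 0` (Silverman AEC VII.2.1) splits this into the component-group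
half `(E/E₀)[p]` (Kodaira–Néron, type `I_n`; NOT in this file) and the half proved here:

* `reducesToZero_of_reducesToZero_nsmul_of_node` — for a Weierstrass equation `M` over a valuation ring `O ⊂ L` (`L` algebraically closed) whose
  reduction is NODAL (`Δ(M̃) = 0`, `c₄(M̃) ≠ 0`) and whose residue field has characteristic `p`: if `P ∈ E₀` (`HasNonsingularReduction`) and
  `p • P ∈ E₁` (`ReducesToZero`) then `P ∈ E₁`.  Proof: the reduction homomorphism `E₀ → M̃_ns(k̄)` (tree `reductionHom`, AEC VII.2.1) has
  kernel `E₁`; `M̃_ns(k̄) ≃ k̄ˣ` for a node over the algebraically closed residue field (tree `nonempty_point_addEquiv_units_of_node`, AEC III.2.5);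
  and `k̄ˣ` has no `p`-torsion in characteristic `p` (Frobenius is injective).
* **`mem_localKernelOfReduction_of_nsmul_mem_of_hasMultiplicativeReductionAt`** — the same for the kernel of reduction `E₁(K̄_v) =
  localKernelOfReduction v` of an elliptic curve over a number field `K` at a place `v ∋ p` of multiplicative reduction, `E₀` being
  `HasNonsingularReduction` on the spectral model.

References: J. H. Silverman, AEC (2009), Prop. III.2.5, Prop. VII.2.1, VII.5.1(b) [SilvermanAEC2009]; J. Tate, «Algorithm for determining the
type of a singular fiber», LNM 476 (1975), §7 case I_n (the other half) [Tate1975Algorithm].  BSD is not proved by any of this.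
-/

noncomputable section

open scoped NNReal Classical
open NumberField IsDedekindDomain Field

namespace WeierstrassCurve

open Literature.NumberTheory.EllipticCurves Literature.NumberTheory.GaloisRepresentations
  IsDedekindDomain.HeightOneSpectrum AddSubgroup

universe u v

/-! ## §1 A nodal Weierstrass equation over a valuation ring of an algebraically closed field -/

/-- **`(E₀/E₁)[p] = 0` for a nodal reduction in characteristic `p`.**  Let `O ⊂ L` be a valuation ring of an algebraically closed field with
residue characteristic `p`, `M` a Weierstrass equation over `O` with nodal reduction (`Δ(M̃) = 0 ≠ c₄(M̃)`).  If `P ∈ M(L)` has nonsingular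
reduction and `p • P` reduces to `O`, then `P` reduces to `O`: `E₀/E₁ ↪ M̃_ns(k̄) ≃ k̄ˣ` (AEC VII.2.1, III.2.5) and `k̄ˣ[p] = 1` in characteristic
`p`. [cite: SilvermanAEC2009, Prop. VII.2.1 (PDF p. 167)] [cite: SilvermanAEC2009, Prop. III.2.5] -/
theorem reducesToZero_of_reducesToZero_nsmul_of_node {L : Type u} [Field L] [IsAlgClosed L] (O : ValuationSubring L)
    {Γ₀ : Type v} [LinearOrderedCommGroupWithZero Γ₀] {ν : Valuation L Γ₀} (hν : ν.Integers O)
    {M : WeierstrassCurve O} (hΔ : (M.map (IsLocalRing.residue O)).Δ = 0) (hc₄ : (M.map (IsLocalRing.residue O)).c₄ ≠ 0)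
    {p : ℕ} [hp : Fact p.Prime] [CharP (IsLocalRing.ResidueField O) p]
    {P : (M.baseChange L).toAffine.Point} (hP : HasNonsingularReduction M P) (hpP : ReducesToZero M (p • P)) :
    ReducesToZero M P := by
  haveI : IsAlgClosed (IsLocalRing.ResidueField O) := Literature.RingTheory.Valuation.isAlgClosed_residueField O
  haveI : ExpChar (IsLocalRing.ResidueField O) p := ExpChar.prime hp.out
  -- the reduction homomorphism `E₀ → M̃_ns(k̄)` with kernel `E₁`
  set P₀ : nonsingularReductionSubgroup M hν := ⟨P, hP⟩ with hP₀
  have hpP₀ : HasNonsingularReduction M (p • P) := (nonsingularReductionSubgroup M hν).nsmul_mem hP p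
  have hred : reductionHom M hν (p • P₀) = 0 := by
    rw [reductionHom_apply]
    exact (reducePoint_eq_zero_iff hν hpP₀).mpr hpP
  rw [map_nsmul] at hred
  -- `M̃_ns(k̄) ≃ k̄ˣ`, no `p`-torsion in characteristic `p`
  obtain ⟨e⟩ := (M.map (IsLocalRing.residue O)).nonempty_point_addEquiv_units_of_node hΔ hc₄
  set Q := reductionHom M hν P₀ with hQ
  have h1 : p • e Q = 0 := by rw [← map_nsmul, hred, map_zero]
  have h2 : (Additive.toMul (e Q)) ^ p = 1 := by rw [← toMul_nsmul, h1, toMul_zero]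
  have h3 : Additive.toMul (e Q) = 1 := by
    have h2' : ((Additive.toMul (e Q) : (IsLocalRing.ResidueField O)ˣ) : IsLocalRing.ResidueField O) ^ p = 1 := by
      rw [← Units.val_pow_eq_pow_val, h2, Units.val_one]
    have h4 : ((Additive.toMul (e Q) : (IsLocalRing.ResidueField O)ˣ) : IsLocalRing.ResidueField O) = 1 := by
      apply frobenius_inj (IsLocalRing.ResidueField O) p
      rw [frobenius_def, frobenius_def, one_pow, h2']
    exact Units.ext h4
  have hQ0 : Q = 0 := by
    apply e.injective
    rw [map_zero]
    exact Additive.toMul.injective (by rw [h3, toMul_zero])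
  have hQ0' : reducePoint M P = 0 := by
    rw [hQ, reductionHom_apply] at hQ0
    exact hQ0
  exact (reducePoint_eq_zero_iff hν hP).mp hQ0'

/-! ## §2 At a place of multiplicative reduction of a number field -/

section NumberField

variable {K : Type u} [Field K] [NumberField K] (W : WeierstrassCurve K)
  (v : HeightOneSpectrum (𝓞 K))

/-- The reduced minimal model `Ẽ_v` is nodal at a place of multiplicative reduction: `Δ(Ẽ_v) = 0` and `c₄(Ẽ_v) ≠ 0`.
[cite: SilvermanAEC2009, VII.5 Prop. 5.1(b)] -/
theorem reductionAt_Δ_eq_zero_and_c₄_ne_zero_of_hasMultiplicativeReductionAt (hmult : W.HasMultiplicativeReductionAt v) :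
    (W.reductionAt v).Δ = 0 ∧ (W.reductionAt v).c₄ ≠ 0 := by
  obtain ⟨hΔ, hc₄⟩ := (hasMultiplicativeReductionAt_iff_mem v W).mp hmult
  rw [reductionAt_eq_map_residue, map_Δ, map_c₄]
  exact ⟨(IsLocalRing.residue_eq_zero_iff _).mpr hΔ, fun h0 ↦ hc₄ ((IsLocalRing.residue_eq_zero_iff _).mp h0)⟩

/-- **`(E₀(K̄_v)/E₁(K̄_v))[p] = 0` at a place `v ∋ p` of multiplicative reduction**: a point of `E(K̄_v)` with nonsingular reduction (on the
minimal model at `v`) whose `p`-multiple lies in the kernel of reduction `E₁(K̄_v)` lies in `E₁(K̄_v)` — `E₀/E₁ ≃ Ẽ_ns(k̄_v) ≃ k̄_vˣ` has no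
`p`-torsion. (The component-group half `(E/E₀)[p]` of the divisibility of `E₁(K̄_v)` at a multiplicative place is NOT proved here.)
[cite: SilvermanAEC2009, Prop. VII.2.1 and Prop. III.2.5] -/
theorem mem_localKernelOfReduction_of_nsmul_mem_of_hasMultiplicativeReductionAt {p : ℕ} [hp : Fact p.Prime]
    (hpv : (p : 𝓞 K) ∈ v.asIdeal) (hmult : W.HasMultiplicativeReductionAt v)
    {P : localPoints W (v.adicCompletion K)}
    (hP : HasNonsingularReduction (W.localSpectralModel v) (W.localPointsEquivSpectralModel v P))
    (hpP : p • P ∈ W.localKernelOfReduction v) : P ∈ W.localKernelOfReduction v := by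
  let O : ValuationSubring (AlgebraicClosure (v.adicCompletion K)) := (v.spectralValuation).valuationSubring
  have hvO : (v.spectralValuation).Integers O := Valuation.valuationSubring.integers _
  haveI hkv : CharP (IsLocalRing.ResidueField (v.adicCompletionIntegers K)) p :=
    ringChar.of_eq (ringChar_residueField_eq v hp.out hpv)
  haveI : CharP (IsLocalRing.ResidueField O) p := (RingHom.charP_iff_charP (v.residueFieldToSpectral) p).mp hkv
  obtain ⟨hΔ, hc₄⟩ := W.reductionAt_Δ_eq_zero_and_c₄_ne_zero_of_hasMultiplicativeReductionAt v hmult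
  -- the reduction of the spectral model is `Ẽ_v ⊗ k̄_v`: nodal
  have hΔ' : ((show WeierstrassCurve O from W.localSpectralModel v).map (IsLocalRing.residue O)).Δ = 0 := by
    have h : ((W.localSpectralModel v).map (IsLocalRing.residue _)).Δ = 0 := by
      rw [localSpectralModel_map_residue, map_Δ]
      change v.residueFieldToSpectral (W.reductionAt v).Δ = 0
      rw [hΔ, map_zero]
    exact h
  have hc₄' : ((show WeierstrassCurve O from W.localSpectralModel v).map (IsLocalRing.residue O)).c₄ ≠ 0 := by
    have h : ((W.localSpectralModel v).map (IsLocalRing.residue _)).c₄ ≠ 0 := by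
      rw [localSpectralModel_map_residue, map_c₄]
      change v.residueFieldToSpectral (W.reductionAt v).c₄ ≠ 0
      exact (map_ne_zero_iff _ (RingHom.injective _)).mpr hc₄
    exact h
  have hpP' : ReducesToZero (W.localSpectralModel v) (p • W.localPointsEquivSpectralModel v P) := by
    have h := (W.mem_localKernelOfReduction_iff v _).mp hpP
    rwa [map_nsmul] at h
  have key := reducesToZero_of_reducesToZero_nsmul_of_node O hvO
    (M := show WeierstrassCurve O from W.localSpectralModel v) hΔ' hc₄' (p := p)
    (P := W.localPointsEquivSpectralModel v P) hP hpP'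
  exact (W.mem_localKernelOfReduction_iff v P).mpr key

end NumberField

end WeierstrassCurve

end
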